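import Literature.NumberTheory.LFunctions.WeilConjecturesDeligneReductionProofs
import Literature.AlgebraicGeometry.Motives.SegreEmbedding
import Mathlib.LinearAlgebra.Charpoly.BaseChange
import Mathlib.LinearAlgebra.Eigenspace.Charpoly
import Mathlib.LinearAlgebra.Dual.Lemmas
import Mathlib.RingTheory.Flat.Basic
import HarnessLib

/-!
# Deligne's *Weil I*, (7.3): the Künneth step (7.1) ⟹ (7.2), for a Galois Weil cohomology theory

Deligne, *La conjecture de Weil. I*, Publ. Math. IHÉS 43 (1974), §7, proves the key Lemma (1.7)
(purity of the eigenvalues of Frobenius) in three steps: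

* **Lemme (7.1)** (p. 298): for `X₀` projective, smooth, absolutely irreducible of *even*
  dimension `d` over `𝔽_q` and `α` an eigenvalue of `F*` on the middle cohomology `Hᵈ(X, ℚ_ℓ)`,
  `α` is an algebraic number all of whose complex conjugates satisfy
  `q^{d/2 - 1/2} ≤ |α| ≤ q^{d/2 + 1/2}` ((7.1.1); Lefschetz pencils, Kazhdan–Margulis, Rankin);
* **Lemme (7.2)** (p. 300): the same for `X₀` of *any* dimension `d`, with the conclusion
  `|α| = q^{d/2}`; its proof (7.3) (p. 301) is the tensor-power trick: "Pour tout entier `k`, `αᵏ`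
  est valeur propre de `F*` agissant sur `H^{kd}(Xᵏ, ℚ_ℓ)` (formule de Künneth). Pour `k` pair,
  `Xᵏ` est justiciable de (7.1), d'où `q^{kd/2 - 1/2} ≤ |α|ᵏ ≤ q^{kd/2 + 1/2}` et faisant tendre
  `k` vers l'infini, on trouve (7.2)";
* **(7.2) ⟹ (1.7)** (p. 301, a)–d)): extension of scalars, Poincaré duality, sums, and the weak
  Lefschetz theorem for a smooth hyperplane section.

This file proves the middle step **(7.3): (7.1) ⟹ (7.2)** for an *arbitrary* Galois Weil
cohomology theory `E : GaloisWeilCohomology k K χ` over a finite field `k`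
(`Literature.AlgebraicGeometry.Motives.GaloisWeilCohomology`: Weil cohomology with a Galois action,
equivariant pull-backs and cup products), using only the Künneth axiom (B)
(`WeilCohomology.bijective_kunnethMap`) and the stability of smooth projective varieties under
products (`IsSmoothProjective.tensor_holds`, Segre). No trace formula is needed for this step.

## Main results

* `WeilDeligneKunneth.isRoot_charpoly_mul_of_bilin` — linear algebra: if a bilinear map
  `B : V × W → U` intertwines `(f, g)` with `h` and is injective on `V ⊗ W`, then the product of a
  root of `χ_f` and a root of `χ_g` (in any extension field `L ⊇ K`) is a root of `χ_h`.
* `WeilDeligneKunneth.ρ_externalCup` — the external cup product `pr₁* x ∪ pr₂* y` on `X × Y` is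
  Galois equivariant; `WeilDeligneKunneth.injective_lift_externalCup` — it is injective on
  `Hⁱ(X) ⊗ Hʲ(Y)` (a Künneth summand).
* `WeilDeligneKunneth.isRoot_charpoly_ρ_tensor`, `…_frobAction_tensor` — **Künneth formula for
  eigenvalues**: if `α` is an eigenvalue of `g ∈ Γ_k` (e.g. the geometric Frobenius) on `Hⁱ(X)` and
  `β` one on `Hʲ(Y)`, then `αβ` is an eigenvalue on `Hⁱ⁺ʲ(X × Y)`;
  `WeilDeligneKunneth.exists_isRoot_charpoly_ρ_pow` — `αᵐ⁺¹` is an eigenvalue on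
  `H^{(m+1)i}(Xᵐ⁺¹)`.
* `frobEigenvalue_middle_norm_eq_of_even_dim_bound` — **Deligne (7.3): (7.1) ⟹ (7.2)** for `E`.
* `isRoot_charpoly_frobAction_dual`, `frobEigenvalue_norm_eq_of_dual` — p. 301 b): the eigenvalues
  on `H²ⁿ⁻ⁱ(X)` are the `qⁿ/α`, so `W(X, i) ⟹ W(X, 2n - i)` (Poincaré duality, `χ(φ) = q`);
  `frobEigenvalue_norm_eq_zero` — `W(X, 0)` (`F = 1` on `H⁰`).
* `frobEigenvalue_norm_eq_of_lemma71_of_weakLefschetz` — the dévissage of p. 301 assembled: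
  (7.1) and a weak-Lefschetz hypothesis (WL) (abstracting steps a), d)) give `W(X, i)` for all
  `i`, i.e. (1.7) for `E`; with the trace formula, `deligneWeilIStatement_of_lemma71_of_weakLefschetz`
  and `exists_isWeilFactorization_of_lemma71_of_weakLefschetz` ((1.6) and the Weil factorisation).

## References

* P. Deligne, *La conjecture de Weil. I*, Publ. Math. IHÉS 43 (1974), 273–307: Lemme (7.1)
  p. 298, Lemme (7.2) p. 300, (7.3) p. 301. [Deligne1974]
* S. Kleiman, *Algebraic cycles and the Weil conjectures*, in: Dix exposés sur la cohomologie des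
  schémas (1968), §1.2 (B) (Künneth axiom). [Kleiman1968AlgebraicCycles]

## Design notes

* Eigenvalues live in an arbitrary extension field `L` of the coefficient field `K` (as in
  `weilRiemannHypothesisFor_of_eigenvalues`): "`α` is an eigenvalue of `F*` on `Hⁱ(X)`" is
  "`α` is a root of the image in `L[T]` of the characteristic polynomial of `E.frobAction X i`".
  The linear algebra is done after base change to `L` (`LinearMap.charpoly_baseChange`,
  `Module.End.hasEigenvalue_iff_isRoot_charpoly`), where eigenvectors exist; injectivity of the
  Künneth summand survives base change by flatness of `L` over `K`.
* Powers `Xᵐ` are not introduced as a definition: `exists_isRoot_charpoly_ρ_pow` produces *some*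
  smooth projective `Y` (namely `X × (X × ⋯)`) of dimension `(m+1)·dim X` carrying the eigenvalue
  `αᵐ⁺¹` in degree `(m+1)·i`, which is all (7.3) uses.
* (7.1) and (7.2) are stated for `E` exactly as printed (algebraic eigenvalue, bounds on all complex
  conjugates, even dimension and middle degree in (7.1)); "absolument irréductible" is part of
  `IsSmoothProjective` (geometric irreducibility). Of the dévissage (7.2) ⟹ (1.7) (p. 301), steps
  b) (Poincaré duality) and the degree-`0` case are proved for `E` (given `χ(φ) = q`); steps a)
  (extension of scalars) and d) (weak Lefschetz for a smooth hyperplane section) are not available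
  for an abstract `E` and enter as the explicit hypothesis (WL) of
  `frobEigenvalue_norm_eq_of_lemma71_of_weakLefschetz`.
-/

universe u v

open CategoryTheory AlgebraicGeometry MonoidalCategory CartesianMonoidalCategory Polynomial
open scoped TensorProduct

noncomputable section

namespace Literature.NumberTheory.LFunctions

namespace WeilDeligneKunneth

/-! ### Linear algebra: eigenvalues multiply along an equivariant injective bilinear map -/

section LinearAlgebra

variable {K : Type*} [Field K] {L : Type*} [Field L] [Algebra K L]
  {V W U : Type*} [AddCommGroup V] [Module K V] [AddCommGroup W] [Module K W]
  [AddCommGroup U] [Module K U]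

/-- Over a field, the elementary tensor of two nonzero vectors is nonzero (test against a pair of
linear forms not vanishing on them). [folklore] -/
theorem tmul_ne_zero {v : V} {w : W} (hv : v ≠ 0) (hw : w ≠ 0) : v ⊗ₜ[K] w ≠ 0 := by
  obtain ⟨φ, hφ⟩ := Module.Projective.exists_dual_ne_zero K hv
  obtain ⟨ψ, hψ⟩ := Module.Projective.exists_dual_ne_zero K hw
  intro h
  have h' : TensorProduct.lift ((LinearMap.mul K K).compl₁₂ φ ψ) (v ⊗ₜ[K] w) = φ v * ψ w := by
    rw [TensorProduct.lift.tmul]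
    rfl
  rw [h, map_zero] at h'
  exact mul_ne_zero hφ hψ h'.symm

/-- Naturality of `L ⊗_K (V ⊗_K W) ≃ (L ⊗_K V) ⊗_L (L ⊗_K W)` (Mathlib
`TensorProduct.AlgebraTensorModule.distribBaseChange`) with respect to endomorphisms of `V` and
`W`: the base change of `f ⊗ g` corresponds to `f_L ⊗_L g_L`. [folklore] -/
theorem distribBaseChange_symm_map (f : Module.End K V) (g : Module.End K W)
    (t : (L ⊗[K] V) ⊗[L] (L ⊗[K] W)) :
    (TensorProduct.map f g).baseChange L
        ((TensorProduct.AlgebraTensorModule.distribBaseChange K L V W).symm t) =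
      (TensorProduct.AlgebraTensorModule.distribBaseChange K L V W).symm
        (TensorProduct.map (f.baseChange L) (g.baseChange L) t) := by
  induction t using TensorProduct.induction_on with
  | zero => simp only [map_zero]
  | add x y hx hy => simp only [map_add, hx, hy]
  | tmul x y =>
    induction x using TensorProduct.induction_on with
    | zero => simp only [TensorProduct.zero_tmul, map_zero]
    | add x₁ x₂ h₁ h₂ => simp only [TensorProduct.add_tmul, map_add, h₁, h₂]
    | tmul a v₀ =>
      induction y using TensorProduct.induction_on with
      | zero => simp only [TensorProduct.tmul_zero, map_zero]
      | add y₁ y₂ h₁ h₂ => simp only [TensorProduct.tmul_add, map_add, h₁, h₂]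
      | tmul b w₀ =>
        simp only [TensorProduct.map_tmul, LinearMap.baseChange_tmul,
          TensorProduct.AlgebraTensorModule.distribBaseChange_symm_tmul]

/-- **Eigenvalues multiply along an equivariant, injective bilinear map.** Let `f`, `g`, `h` be
endomorphisms of finite-dimensional `K`-vector spaces `V`, `W`, `U` and `B : V × W → U` a bilinear
map with `B(f v, g w) = h(B(v, w))` which is injective on `V ⊗ W`. If `α ∈ L` is a root of the
characteristic polynomial of `f` and `β ∈ L` one of `g` (`L ⊇ K` any field), then `αβ` is a root
of the characteristic polynomial of `h`. Proof: after base change to `L` pick eigenvectors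
`v`, `w`; then `B_L(v ⊗ w)` is an eigenvector of `h_L` for `αβ`, nonzero because `B_L` is still
injective (`L` is flat over `K`) and `v ⊗ w ≠ 0`. This is the linear algebra behind "`αᵏ` est
valeur propre de `F*` agissant sur `H^{kd}(Xᵏ)` (formule de Künneth)" (Deligne 1974, (7.3)).
[folklore] -/
theorem isRoot_charpoly_mul_of_bilin [Module.Finite K V] [Module.Finite K W] [Module.Finite K U]
    {f : Module.End K V} {g : Module.End K W} {h : Module.End K U} (B : V →ₗ[K] W →ₗ[K] U)
    (hB : ∀ v w, B (f v) (g w) = h (B v w)) (hinj : Function.Injective (TensorProduct.lift B))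
    {α β : L} (hα : (f.charpoly.map (algebraMap K L)).IsRoot α)
    (hβ : (g.charpoly.map (algebraMap K L)).IsRoot β) :
    (h.charpoly.map (algebraMap K L)).IsRoot (α * β) := by
  rw [← LinearMap.charpoly_baseChange, ← Module.End.hasEigenvalue_iff_isRoot_charpoly] at hα hβ ⊢
  obtain ⟨v, hv⟩ := hα.exists_hasEigenvector
  obtain ⟨w, hw⟩ := hβ.exists_hasEigenvector
  set θ := (TensorProduct.AlgebraTensorModule.distribBaseChange K L V W).symm with hθ
  set z : L ⊗[K] (V ⊗[K] W) := θ (v ⊗ₜ[L] w) with hz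
  -- `B ∘ (f ⊗ g) = h ∘ B` on `V ⊗ W`
  have hBt : TensorProduct.lift B ∘ₗ TensorProduct.map f g = h ∘ₗ TensorProduct.lift B :=
    TensorProduct.ext' fun v w => by
      simp only [LinearMap.comp_apply, TensorProduct.map_tmul, TensorProduct.lift.tmul, hB]
  -- `(f ⊗ g)_L z = (αβ) • z`
  have h1 : (TensorProduct.map f g).baseChange L z = (α * β) • z := by
    rw [hz, distribBaseChange_symm_map, TensorProduct.map_tmul, hv.apply_eq_smul,
      hw.apply_eq_smul, TensorProduct.smul_tmul_smul, map_smul]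
  -- hence `h_L (B_L z) = (αβ) • B_L z`
  have h2 : (h.baseChange L) ((TensorProduct.lift B).baseChange L z) =
      (α * β) • (TensorProduct.lift B).baseChange L z := by
    have := congrArg (fun φ => (LinearMap.baseChange L φ) z) hBt
    simp only [LinearMap.baseChange_comp, LinearMap.comp_apply] at this
    rw [← this, h1, map_smul]
  refine Module.End.hasEigenvalue_of_hasEigenvector ⟨Module.End.mem_eigenspace_iff.mpr h2, ?_⟩
  -- and `B_L z ≠ 0`
  have hinjL : Function.Injective ((TensorProduct.lift B).baseChange L) := by
    rw [LinearMap.baseChange_eq_ltensor]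
    exact Module.Flat.lTensor_preserves_injective_linearMap _ hinj
  intro h0
  have hz0 : z = 0 := hinjL (by rw [h0, map_zero])
  rw [hz, LinearEquiv.map_eq_zero_iff] at hz0
  exact tmul_ne_zero hv.right hw.right hz0

end LinearAlgebra

/-! ### Künneth formula for eigenvalues in a Galois Weil cohomology theory -/

section Kunneth

open Literature.AlgebraicGeometry.Motives

variable {k : Type u} [Field k] {K : Type v} [Field K] [CharZero K]
  {χ : Field.absoluteGaloisGroup k →* Kˣ} (E : GaloisWeilCohomology k K χ)
  {n m : ℕ} {X Y : SchemeOver k}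

/-- **The external cup product is Galois equivariant**: for `X`, `Y` smooth projective,
`g · (pr₁* x ∪ pr₂* y) = pr₁* (g · x) ∪ pr₂* (g · y)` on `X × Y` (equivariance of pull-backs and
cup products, `GaloisWeilCohomology.pullback_ρ`, `cup_ρ`, applied on the smooth projective
`X × Y`, `IsSmoothProjective.tensor_holds`). [folklore] -/
theorem ρ_externalCup (hX : IsSmoothProjective n X) (hY : IsSmoothProjective m Y) {i j d : ℕ}
    (h : i + j = d) (g : Field.absoluteGaloisGroup k) (x : E.obj X i) (y : E.obj Y j) :
    E.ρ (X ⊗ Y) d g (E.externalCup X Y h x y) =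
      E.externalCup X Y h (E.ρ X i g x) (E.ρ Y j g y) := by
  have hXY : IsSmoothProjective (n + m) (X ⊗ Y) := IsSmoothProjective.tensor_holds hX hY
  have h₁ := LinearMap.congr_fun (E.pullback_ρ hXY hX (fst X Y) i g) x
  have h₂ := LinearMap.congr_fun (E.pullback_ρ hXY hY (snd X Y) j g) y
  simp only [LinearMap.comp_apply] at h₁ h₂
  change E.ρ (X ⊗ Y) d g (E.cup h (E.pullback (fst X Y) i x) (E.pullback (snd X Y) j y)) =
    E.cup h (E.pullback (fst X Y) i (E.ρ X i g x)) (E.pullback (snd X Y) j (E.ρ Y j g y))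
  rw [E.cup_ρ hXY h g, h₁, h₂]

/-- **A Künneth summand embeds**: for `X`, `Y` smooth projective the external cup product
`Hⁱ(X) ⊗ Hʲ(Y) → Hⁱ⁺ʲ(X × Y)`, `x ⊗ y ↦ pr₁* x ∪ pr₂* y`, is injective — it is the restriction of
the Künneth isomorphism `⨁_{a+b=d} Hᵃ(X) ⊗ Hᵇ(Y) ≅ Hᵈ(X × Y)` (axiom (B), Kleiman 1968 §1.2,
`WeilCohomology.bijective_kunnethMap`) to the summand `(i, j)`. [cite: Kleiman1968AlgebraicCycles, §1.2 (B)] -/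
theorem injective_lift_externalCup (hX : IsSmoothProjective n X) (hY : IsSmoothProjective m Y)
    {i j d : ℕ} (h : i + j = d) :
    Function.Injective (TensorProduct.lift (E.externalCup X Y h)) := by
  classical
  let ij : ↥(Finset.antidiagonal d) := ⟨(i, j), Finset.mem_antidiagonal.mpr h⟩
  have heq : ∀ t, TensorProduct.lift (E.externalCup X Y h) t =
      E.kunnethMap X Y d (DirectSum.lof K _ (fun ij : ↥(Finset.antidiagonal d) ↦
        E.obj X ij.1.1 ⊗[K] E.obj Y ij.1.2) ij t) := fun t => by
    rw [PreWeilCohomology.kunnethMap, DirectSum.toModule_lof]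
  intro t₁ t₂ ht
  rw [heq, heq] at ht
  exact DirectSum.of_injective
    (β := fun ij : ↥(Finset.antidiagonal d) ↦ E.obj X ij.1.1 ⊗[K] E.obj Y ij.1.2) ij
    ((E.bijective_kunnethMap hX hY d).1 ht)

/-- **Künneth formula for eigenvalues of the Galois action.** Let `X`, `Y` be smooth projective,
`g ∈ Γ_k`, and `L ⊇ K` a field. If `α ∈ L` is an eigenvalue of `g` on `Hⁱ(X)` (a root of the
characteristic polynomial of `E.ρ X i g`) and `β ∈ L` an eigenvalue of `g` on `Hʲ(Y)`, then `αβ`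
is an eigenvalue of `g` on `Hⁱ⁺ʲ(X × Y)`: the external cup product of eigenvectors is an
eigenvector (`ρ_externalCup`) and is nonzero (`injective_lift_externalCup`). (Deligne 1974, (7.3):
"formule de Künneth".) [cite: Deligne1974, (7.3) p. 301] -/
theorem isRoot_charpoly_ρ_tensor {L : Type*} [Field L] [Algebra K L] (hX : IsSmoothProjective n X)
    (hY : IsSmoothProjective m Y) (g : Field.absoluteGaloisGroup k) {i j d : ℕ} (h : i + j = d)
    {α β : L}
    (hα : ((haveI := E.finite_obj hX i; (E.ρ X i g).charpoly).map (algebraMap K L)).IsRoot α)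
    (hβ : ((haveI := E.finite_obj hY j; (E.ρ Y j g).charpoly).map (algebraMap K L)).IsRoot β) :
    ((haveI := E.finite_obj (IsSmoothProjective.tensor_holds hX hY) d;
      (E.ρ (X ⊗ Y) d g).charpoly).map (algebraMap K L)).IsRoot (α * β) := by
  haveI := E.finite_obj hX i
  haveI := E.finite_obj hY j
  haveI := E.finite_obj (IsSmoothProjective.tensor_holds hX hY) d
  exact isRoot_charpoly_mul_of_bilin (E.externalCup X Y h)
    (fun x y => (ρ_externalCup E hX hY h g x y).symm) (injective_lift_externalCup E hX hY h) hα hβ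

/-- **Künneth formula for eigenvalues of Frobenius** (Deligne 1974, (7.3)): over a finite field
`k`, if `α` is an eigenvalue of the geometric Frobenius `F` on `Hⁱ(X)` and `β` one on `Hʲ(Y)`
(`X`, `Y` smooth projective), then `αβ` is an eigenvalue of `F` on `Hⁱ⁺ʲ(X × Y)`.
[cite: Deligne1974, (7.3) p. 301] -/
theorem isRoot_charpoly_frobAction_tensor [Finite k] {L : Type*} [Field L] [Algebra K L]
    (hX : IsSmoothProjective n X) (hY : IsSmoothProjective m Y) {i j d : ℕ} (h : i + j = d)
    {α β : L}
    (hα : ((haveI := E.finite_obj hX i; (E.frobAction X i).charpoly).map (algebraMap K L)).IsRoot α)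
    (hβ : ((haveI := E.finite_obj hY j; (E.frobAction Y j).charpoly).map
      (algebraMap K L)).IsRoot β) :
    ((haveI := E.finite_obj (IsSmoothProjective.tensor_holds hX hY) d;
      (E.frobAction (X ⊗ Y) d).charpoly).map (algebraMap K L)).IsRoot (α * β) :=
  isRoot_charpoly_ρ_tensor E hX hY (geomFrob k) h hα hβ

/-- **Eigenvalues on powers** (Deligne 1974, (7.3): "pour tout entier `k`, `αᵏ` est valeur propre
de `F*` agissant sur `H^{kd}(Xᵏ, ℚ_ℓ)`"): if `α` is an eigenvalue of `g ∈ Γ_k` on `Hⁱ(X)`, `X`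
smooth projective of dimension `n`, then for every `m` there is a smooth projective `Y` of
dimension `(m+1)·n` (namely `X × (X × ⋯ × X)`) such that `αᵐ⁺¹` is an eigenvalue of `g` on
`H^{(m+1)i}(Y)`. Induction on `m` with `isRoot_charpoly_ρ_tensor`. [cite: Deligne1974, (7.3) p. 301] -/
theorem exists_isRoot_charpoly_ρ_pow {L : Type*} [Field L] [Algebra K L]
    (hX : IsSmoothProjective n X) (g : Field.absoluteGaloisGroup k) {i : ℕ} {α : L}
    (hα : ((haveI := E.finite_obj hX i; (E.ρ X i g).charpoly).map (algebraMap K L)).IsRoot α)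
    (m : ℕ) :
    ∃ (Y : SchemeOver k) (D e : ℕ) (hY : IsSmoothProjective D Y), D = (m + 1) * n ∧
      e = (m + 1) * i ∧
      ((haveI := E.finite_obj hY e; (E.ρ Y e g).charpoly).map (algebraMap K L)).IsRoot
        (α ^ (m + 1)) := by
  induction m with
  | zero => exact ⟨X, n, i, hX, by ring, by ring, by simpa using hα⟩
  | succ m ih =>
    obtain ⟨Y, D, e, hY, hD, he, hr⟩ := ih
    refine ⟨X ⊗ Y, n + D, i + e, IsSmoothProjective.tensor_holds hX hY, by rw [hD]; ring,
      by rw [he]; ring, ?_⟩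
    have := isRoot_charpoly_ρ_tensor E hX hY g rfl hα hr
    rwa [← pow_succ'] at this

end Kunneth

/-! ### A limiting argument -/

/-- If `0 ≤ s` and `A ≤ s^{2m+2} ≤ B` for all `m` with `A > 0`, then `s = 1` ("faisant tendre `k`
vers l'infini", Deligne 1974, (7.3)): for `s < 1` the even powers tend to `0 < A`, for `s > 1`
they are unbounded. [folklore] -/
theorem eq_one_of_pow_bounds {s A B : ℝ} (hs : 0 ≤ s) (hA : 0 < A)
    (h : ∀ m : ℕ, A ≤ s ^ (2 * m + 2) ∧ s ^ (2 * m + 2) ≤ B) : s = 1 := by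
  rcases lt_trichotomy s 1 with hlt | heq | hgt
  · exfalso
    obtain ⟨N, hN⟩ := exists_pow_lt_of_lt_one hA hlt
    have h1 : s ^ (2 * N + 2) ≤ s ^ N := pow_le_pow_of_le_one hs hlt.le (by omega)
    exact lt_irrefl A (((h N).1.trans h1).trans_lt hN)
  · exact heq
  · exfalso
    obtain ⟨N, hN⟩ := pow_unbounded_of_one_lt B hgt
    have h1 : s ^ N ≤ s ^ (2 * N + 2) := pow_le_pow_right₀ hgt.le (by omega)
    exact lt_irrefl B (hN.trans_le (h1.trans (h N).2))

end WeilDeligneKunneth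

/-! ### Deligne (7.3): Lemma (7.1) implies Lemma (7.2) -/

section Deligne73

open WeilDeligneKunneth
open Literature.AlgebraicGeometry.Motives (GaloisWeilCohomology SchemeOver IsSmoothProjective
  geomFrob)

variable {k : Type u} [Field k] [Finite k] {K : Type v} [Field K] [CharZero K]
  {χ : Field.absoluteGaloisGroup k →* Kˣ} (E : GaloisWeilCohomology k K χ)

/-- **Deligne's (7.3): Lemma (7.1) implies Lemma (7.2)** (Deligne, *La conjecture de Weil. I*,
Publ. Math. IHÉS 43 (1974), p. 301), for an arbitrary Galois Weil cohomology theory `E` over the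
finite field `k` with `q` elements, with coefficients in a field `K` of characteristic zero and
eigenvalues taken in any field `L ⊇ K`. **Hypothesis (Lemme (7.1), p. 298):** for every smooth
projective (geometrically irreducible) `Y` of *even* dimension `d` over `k` and every eigenvalue
`α` of the geometric Frobenius `F` on the middle cohomology `Hᵈ(Y)`, `α` is an algebraic number
all of whose complex conjugates `z` satisfy `q^{d/2 - 1/2} ≤ |z| ≤ q^{d/2 + 1/2}` ((7.1.1)).
**Conclusion (Lemme (7.2), p. 300):** for every smooth projective `X` of dimension `d` (any parity)
and every eigenvalue `α` of `F` on `Hᵈ(X)`, `α` is an algebraic number all of whose complex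
conjugates have absolute value `q^{d/2}`. Proof as printed: `α^{2m+2}` is an eigenvalue of `F` on
the middle cohomology `H^{(2m+2)d}` of the smooth projective `X^{2m+2}` of even dimension
`(2m+2)d` (Künneth, `exists_isRoot_charpoly_ρ_pow`), so by (7.1) `α^{2m+2}` — hence `α` — is
algebraic, and for every complex conjugate `z` of `α`, `z^{2m+2}` is a conjugate of `α^{2m+2}`,
whence `q^{(m+1)d - 1/2} ≤ |z|^{2m+2} ≤ q^{(m+1)d + 1/2}` for all `m`; letting `m → ∞` gives
`|z| = q^{d/2}` (`eq_one_of_pow_bounds`). [cite: Deligne1974, (7.3) p. 301: Lemme (7.1) ⟹ Lemme (7.2)] -/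
theorem frobEigenvalue_middle_norm_eq_of_even_dim_bound {L : Type*} [Field L] [CharZero L]
    [Algebra K L]
    (h71 : ∀ ⦃d : ℕ⦄ ⦃Y : SchemeOver k⦄ (hY : IsSmoothProjective d Y), Even d → ∀ α : L,
      ((haveI := E.finite_obj hY d; (E.frobAction Y d).charpoly).map (algebraMap K L)).IsRoot α →
        _root_.IsIntegral ℚ α ∧ ∀ z : ℂ, ((minpoly ℚ α).map (algebraMap ℚ ℂ)).IsRoot z →
          (Nat.card k : ℝ) ^ ((d : ℝ) / 2 - 1 / 2) ≤ ‖z‖ ∧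
            ‖z‖ ≤ (Nat.card k : ℝ) ^ ((d : ℝ) / 2 + 1 / 2))
    {d : ℕ} {X : SchemeOver k} (hX : IsSmoothProjective d X) {α : L}
    (hα : ((haveI := E.finite_obj hX d; (E.frobAction X d).charpoly).map
      (algebraMap K L)).IsRoot α) :
    _root_.IsIntegral ℚ α ∧
      ∀ z : ℂ, ((minpoly ℚ α).map (algebraMap ℚ ℂ)).IsRoot z →
        ‖z‖ = (Nat.card k : ℝ) ^ ((d : ℝ) / 2) := by
  -- Künneth: `α^(2m+2)` is an eigenvalue of `F` on the middle cohomology of a smooth projective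
  -- variety of even dimension `(2m+2) d`, to which (7.1) applies.
  have hpow : ∀ m : ℕ, _root_.IsIntegral ℚ (α ^ (2 * m + 2)) ∧
      ∀ z : ℂ, ((minpoly ℚ (α ^ (2 * m + 2))).map (algebraMap ℚ ℂ)).IsRoot z →
        (Nat.card k : ℝ) ^ ((((2 * m + 2) * d : ℕ) : ℝ) / 2 - 1 / 2) ≤ ‖z‖ ∧
          ‖z‖ ≤ (Nat.card k : ℝ) ^ ((((2 * m + 2) * d : ℕ) : ℝ) / 2 + 1 / 2) := by
    intro m
    obtain ⟨Y, D, e, hY, hD, he, hr⟩ :=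
      exists_isRoot_charpoly_ρ_pow E hX (geomFrob k) hα (2 * m + 1)
    have h2 : 2 * m + 1 + 1 = 2 * m + 2 := by ring
    rw [h2] at hD he hr
    rw [← hD] at he ⊢
    subst he
    exact h71 hY ⟨(m + 1) * d, by rw [hD]; ring⟩ _ hr
  refine ⟨(hpow 0).1.of_pow (by norm_num), fun z hz => ?_⟩
  have hq0 : (0 : ℝ) < Nat.card k := Nat.cast_pos.mpr Nat.card_pos
  set c : ℝ := (Nat.card k : ℝ) ^ ((d : ℝ) / 2) with hc
  have hc0 : 0 < c := Real.rpow_pos_of_pos hq0 _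
  -- `z^(2m+2)` is a complex conjugate of `α^(2m+2)`
  have hzpow : ∀ m : ℕ, ((minpoly ℚ (α ^ (2 * m + 2))).map (algebraMap ℚ ℂ)).IsRoot
      (z ^ (2 * m + 2)) := by
    intro m
    have hdvd : minpoly ℚ α ∣
        (minpoly ℚ (α ^ (2 * m + 2))).comp (Polynomial.X ^ (2 * m + 2)) :=
      minpoly.dvd ℚ α (by rw [Polynomial.aeval_comp]; simp)
    have := hz.dvd (Polynomial.map_dvd (algebraMap ℚ ℂ) hdvd)
    rwa [Polynomial.map_comp, Polynomial.IsRoot.def, Polynomial.eval_comp, Polynomial.map_pow,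
      Polynomial.map_X, Polynomial.eval_pow, Polynomial.eval_X] at this
  -- rewrite the exponents: `q^{(2m+2)d/2 + t} = c^(2m+2) · q^t`
  have hexp : ∀ (m : ℕ) (t : ℝ), (Nat.card k : ℝ) ^ ((((2 * m + 2) * d : ℕ) : ℝ) / 2 + t) =
      c ^ (2 * m + 2) * (Nat.card k : ℝ) ^ t := by
    intro m t
    have h1 : (((2 * m + 2) * d : ℕ) : ℝ) / 2 = (d : ℝ) / 2 * ((2 * m + 2 : ℕ) : ℝ) := by
      push_cast
      ring
    rw [Real.rpow_add hq0, h1, Real.rpow_mul hq0.le, Real.rpow_natCast]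
  -- the bounds `q^{-1/2} ≤ (|z|/c)^(2m+2) ≤ q^{1/2}`
  have hs : ‖z‖ / c = 1 := by
    refine eq_one_of_pow_bounds (div_nonneg (norm_nonneg z) hc0.le)
      (Real.rpow_pos_of_pos hq0 (-(1 / 2))) (B := (Nat.card k : ℝ) ^ (1 / 2 : ℝ)) fun m => ?_
    obtain ⟨hlo, hhi⟩ := (hpow m).2 _ (hzpow m)
    rw [norm_pow] at hlo hhi
    rw [sub_eq_add_neg, hexp] at hlo
    rw [hexp] at hhi
    have hcp : 0 < c ^ (2 * m + 2) := pow_pos hc0 _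
    rw [div_pow]
    exact ⟨(le_div_iff₀ hcp).mpr (by rwa [mul_comm (c ^ (2 * m + 2))] at hlo),
      (div_le_iff₀ hcp).mpr (by rwa [mul_comm (c ^ (2 * m + 2))] at hhi)⟩
  exact (div_eq_one_iff_eq hc0.ne').mp hs

end Deligne73

/-! ### Deligne's dévissage (7.2) ⟹ (1.7): Poincaré duality, `H⁰`, and the weak-Lefschetz input -/

section Devissage

open WeilDeligneKunneth WeilFunctionalEquation
open Literature.AlgebraicGeometry.Motives (GaloisWeilCohomology SchemeOver IsSmoothProjective
  geomFrob arithFrob)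

variable {k : Type u} [Field k] [Finite k] {K : Type v} [Field K] [CharZero K]
  {χ : Field.absoluteGaloisGroup k →* Kˣ} (E : GaloisWeilCohomology k K χ)

/-- **Eigenvalues of Frobenius in complementary degrees** (Deligne, *Weil I*, (2.4), p. 280: "Si
les `(αⱼ)` sont les valeurs propres du Frobenius géométrique `F` agissant sur `Hⁱ(X, ℚ_ℓ)`, les
valeurs propres de `F` agissant sur `H²ⁿ⁻ⁱ(X, ℚ_ℓ)` sont donc les `(qⁿ αⱼ⁻¹)`"; used on p. 301 b)):
for `E` with `χ(φ) = q`, `X` smooth projective of dimension `n` and `i + j = 2n`, if `β` is an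
eigenvalue of the geometric Frobenius `F` on `Hʲ(X)` then `β ≠ 0` and `qⁿ β⁻¹` is an eigenvalue
of `F` on `Hⁱ(X)` (Poincaré duality (2.3) with `⟨F v, F w⟩ = qⁿ ⟨v, w⟩`,
`WeilFunctionalEquation.charpoly_comp_C_mul_X_of_pairing`, `cupPairing_frobAction`).
[cite: Deligne1974, (2.4) p. 280 and p. 301 b)] -/
theorem isRoot_charpoly_frobAction_dual {L : Type*} [Field L] [Algebra K L]
    (hχ : (χ (arithFrob k) : K) = Nat.card k) {n : ℕ} {X : SchemeOver k}
    (hX : IsSmoothProjective n X) {i j : ℕ} (hij : i + j = 2 * n) {β : L}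
    (hβ : ((haveI := E.finite_obj hX j; (E.frobAction X j).charpoly).map
      (algebraMap K L)).IsRoot β) :
    β ≠ 0 ∧ ((haveI := E.finite_obj hX i; (E.frobAction X i).charpoly).map
      (algebraMap K L)).IsRoot (algebraMap K L ((Nat.card k : K) ^ n) * β⁻¹) := by
  haveI := E.finite_obj hX i
  haveI := E.finite_obj hX j
  haveI := E.isPerfPair_cupPairing hX i j hij
  have hji : j + i = 2 * n := by omega
  haveI := E.isPerfPair_cupPairing hX j i hji
  have hc : ((Nat.card k : K) ^ n) ≠ 0 := pow_ne_zero _ (Nat.cast_ne_zero.mpr Nat.card_pos.ne')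
  obtain ⟨hkey, -⟩ := charpoly_comp_C_mul_X_of_pairing (E.cupPairing X n i j hij)
    (E.frobAction X i) (E.frobAction X j) _ (cupPairing_frobAction E hχ hX hij)
  obtain ⟨-, hdet⟩ := charpoly_comp_C_mul_X_of_pairing (E.cupPairing X n j i hji)
    (E.frobAction X j) (E.frobAction X i) _ (cupPairing_frobAction E hχ hX hji)
  -- `β ≠ 0` since `det F ≠ 0` on `Hʲ(X)`
  have hβ0 : β ≠ 0 := by
    rintro rfl
    apply hdet hc
    rw [Polynomial.IsRoot.def, Polynomial.eval_map, Polynomial.eval₂_at_zero,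
      map_eq_zero] at hβ
    rw [LinearMap.det_eq_sign_charpoly_coeff, hβ, mul_zero]
  refine ⟨hβ0, ?_⟩
  haveI := invertibleOfNonzero hβ0
  have h1 : eval₂ (algebraMap K L) (⅟β) (E.frobAction X j).charpoly.reverse = 0 := by
    rw [eval₂_reverse_eq_zero_iff]
    rwa [Polynomial.IsRoot.def, Polynomial.eval_map] at hβ
  have h2 := congrArg (eval₂ (algebraMap K L) (⅟β)) hkey
  rw [eval₂_mul, h1, mul_zero, eval₂_comp, eval₂_mul, eval₂_C, eval₂_X, invOf_eq_inv] at h2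
  rwa [Polynomial.IsRoot.def, Polynomial.eval_map]

/-- **Deligne, *Weil I*, p. 301 b): `W(X, i) ⟺ W(X, 2n - i)` by Poincaré duality**, for a Galois
Weil cohomology theory `E` over the finite field `k` (`q = #k`) with `χ(φ) = q`. Here `W(X, i)` is
the assertion (p. 301): every eigenvalue `α` of the geometric Frobenius on `Hⁱ(X)` is an algebraic
number all of whose complex conjugates have absolute value `q^{i/2}`. If `W(X, i)` holds and
`i + j = 2n`, `n = dim X`, then `W(X, j)` holds: an eigenvalue `β` on `Hʲ(X)` is `qⁿ/α` for an
eigenvalue `α` on `Hⁱ(X)` (`isRoot_charpoly_frobAction_dual`), so `β` is algebraic and its complex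
conjugates are the `qⁿ/z`, `z` a conjugate of `α`, of absolute value `qⁿ/q^{i/2} = q^{j/2}`.
[cite: Deligne1974, p. 301 b)] -/
theorem frobEigenvalue_norm_eq_of_dual {L : Type*} [Field L] [CharZero L] [Algebra K L]
    (hχ : (χ (arithFrob k) : K) = Nat.card k) {n : ℕ} {X : SchemeOver k}
    (hX : IsSmoothProjective n X) {i j : ℕ} (hij : i + j = 2 * n)
    (hW : ∀ α : L, ((haveI := E.finite_obj hX i; (E.frobAction X i).charpoly).map
        (algebraMap K L)).IsRoot α →
      _root_.IsIntegral ℚ α ∧ ∀ z : ℂ, ((minpoly ℚ α).map (algebraMap ℚ ℂ)).IsRoot z →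
        ‖z‖ = (Nat.card k : ℝ) ^ ((i : ℝ) / 2))
    {β : L} (hβ : ((haveI := E.finite_obj hX j; (E.frobAction X j).charpoly).map
      (algebraMap K L)).IsRoot β) :
    _root_.IsIntegral ℚ β ∧ ∀ z : ℂ, ((minpoly ℚ β).map (algebraMap ℚ ℂ)).IsRoot z →
      ‖z‖ = (Nat.card k : ℝ) ^ ((j : ℝ) / 2) := by
  obtain ⟨hβ0, hα⟩ := isRoot_charpoly_frobAction_dual E hχ hX hij hβ
  set Q : ℚ := (Nat.card k : ℚ) ^ n with hQ
  have hQ0 : Q ≠ 0 := pow_ne_zero _ (Nat.cast_ne_zero.mpr Nat.card_pos.ne')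
  have hQL : algebraMap K L ((Nat.card k : K) ^ n) = algebraMap ℚ L Q := by
    rw [hQ, map_pow, map_pow, map_natCast, map_natCast]
  rw [hQL] at hα
  set α : L := algebraMap ℚ L Q * β⁻¹ with hαdef
  obtain ⟨hαi, hαz⟩ := hW α hα
  have hαQ : algebraMap ℚ L Q ≠ 0 := by
    rw [map_ne_zero_iff _ (algebraMap ℚ L).injective]; exact hQ0
  have hα0 : α ≠ 0 := mul_ne_zero hαQ (inv_ne_zero hβ0)
  have hβα : β = algebraMap ℚ L Q * α⁻¹ := by
    rw [hαdef, mul_inv, inv_inv, ← mul_assoc, mul_inv_cancel₀ hαQ, one_mul]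
  -- `β` is algebraic
  have hβi : _root_.IsIntegral ℚ β := by
    rw [hβα]
    exact (isIntegral_algebraMap).mul
      (isAlgebraic_iff_isIntegral.mp (isAlgebraic_iff_isIntegral.mpr hαi).inv)
  refine ⟨hβi, fun z hz => ?_⟩
  -- the polynomial `P^rev(Q⁻¹ T)` kills `β`, `P = minpoly ℚ α`
  set P := minpoly ℚ α with hP
  have hPm : P.Monic := minpoly.monic hαi
  haveI := invertibleOfNonzero hα0
  have hrev : eval₂ (algebraMap ℚ L) (⅟α) P.reverse = 0 := by
    rw [eval₂_reverse_eq_zero_iff, ← Polynomial.aeval_def, hP, minpoly.aeval]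
  have hdvd : minpoly ℚ β ∣ P.reverse.comp (C Q⁻¹ * Polynomial.X) := by
    refine minpoly.dvd ℚ β ?_
    rw [Polynomial.aeval_def, eval₂_comp, eval₂_mul, eval₂_C, eval₂_X]
    have : algebraMap ℚ L Q⁻¹ * β = ⅟α := by
      rw [invOf_eq_inv, hαdef, mul_inv, inv_inv, map_inv₀]
    rw [this, hrev]
  have hz' := hz.dvd (Polynomial.map_dvd (algebraMap ℚ ℂ) hdvd)
  rw [Polynomial.map_comp, Polynomial.IsRoot.def, Polynomial.eval_comp, Polynomial.map_mul,
    Polynomial.map_C, Polynomial.map_X, Polynomial.eval_mul, Polynomial.eval_C,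
    Polynomial.eval_X, Polynomial.eval_map] at hz'
  -- `y := Q⁻¹ z ≠ 0` and `y⁻¹ = Q / z` is a conjugate of `α`
  set y : ℂ := algebraMap ℚ ℂ Q⁻¹ * z with hy
  have hy0 : y ≠ 0 := by
    intro hy0
    rw [hy0, eval₂_at_zero, coeff_zero_reverse, hPm.leadingCoeff, map_one] at hz'
    exact one_ne_zero hz'
  haveI : Invertible y⁻¹ := invertibleOfNonzero (inv_ne_zero hy0)
  have hroot : ((minpoly ℚ α).map (algebraMap ℚ ℂ)).IsRoot y⁻¹ := by
    rw [Polynomial.IsRoot.def, Polynomial.eval_map, ← hP]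
    exact (eval₂_reverse_eq_zero_iff (algebraMap ℚ ℂ) y⁻¹ P).mp (by rwa [invOf_eq_inv, inv_inv])
  have hnorm := hαz _ hroot
  -- `‖z‖ = Q ‖y‖ = Q / q^{i/2} = q^{j/2}`
  have hq0 : (0 : ℝ) < Nat.card k := Nat.cast_pos.mpr Nat.card_pos
  have hzy : z = (Q : ℂ) * y := by
    rw [hy, ← mul_assoc, eq_ratCast, Rat.cast_inv, mul_inv_cancel₀ (by exact_mod_cast hQ0), one_mul]
  rw [norm_inv] at hnorm
  rw [hzy, norm_mul, ← inv_inv ‖y‖, hnorm, hQ]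
  push_cast
  rw [norm_pow, Complex.norm_natCast, ← Real.rpow_natCast, ← Real.rpow_neg hq0.le,
    ← Real.rpow_add hq0]
  congr 1
  have : (j : ℝ) = 2 * n - i := by
    have := congrArg (fun x : ℕ => (x : ℝ)) hij; push_cast at this; linarith
  rw [this]; ring


/-- **`W(X, 0)`**: the only eigenvalue of the geometric Frobenius on `H⁰(X)` is `1`, for `E` with
`χ(φ) = q` and `X` smooth projective (`F = 1` on the line `H⁰(X)`,
`WeilFactorization.frobAction_apply_zero`; Deligne, *Weil I*, p. 277: "pour `i = 0`", (2.3)–(2.5)).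
[cite: Deligne1974, (2.5) and p. 301 b)] -/
theorem frobEigenvalue_zero_eq_one {L : Type*} [Field L] [Algebra K L]
    (hχ : (χ (arithFrob k) : K) = Nat.card k) {n : ℕ} {X : SchemeOver k}
    (hX : IsSmoothProjective n X) {α : L}
    (hα : ((haveI := E.finite_obj hX 0; (E.frobAction X 0).charpoly).map
      (algebraMap K L)).IsRoot α) : α = 1 := by
  haveI := E.finite_obj hX 0
  rw [WeilFactorization.charpoly_eq_X_sub_C_of_finrank_eq_one (E.finrank_obj_zero hX) (c := 1)
    (fun v => by rw [one_smul]; exact WeilFactorization.frobAction_apply_zero E hχ hX v),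
    Polynomial.map_sub, Polynomial.map_X, Polynomial.map_C, map_one, Polynomial.IsRoot.def,
    eval_sub, eval_X, eval_C, sub_eq_zero] at hα
  exact hα

/-- **`W(X, 0)` holds** (Deligne, *Weil I*, p. 301): the eigenvalues of Frobenius on `H⁰(X)` are
algebraic numbers (namely `1`) all of whose complex conjugates have absolute value `q⁰ = 1`.
[cite: Deligne1974, p. 301 and (2.5)] -/
theorem frobEigenvalue_norm_eq_zero {L : Type*} [Field L] [CharZero L] [Algebra K L]
    (hχ : (χ (arithFrob k) : K) = Nat.card k) {n : ℕ} {X : SchemeOver k}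
    (hX : IsSmoothProjective n X) {α : L}
    (hα : ((haveI := E.finite_obj hX 0; (E.frobAction X 0).charpoly).map
      (algebraMap K L)).IsRoot α) :
    _root_.IsIntegral ℚ α ∧ ∀ z : ℂ, ((minpoly ℚ α).map (algebraMap ℚ ℂ)).IsRoot z →
      ‖z‖ = (Nat.card k : ℝ) ^ (((0 : ℕ) : ℝ) / 2) := by
  obtain rfl := frobEigenvalue_zero_eq_one E hχ hX hα
  refine ⟨isIntegral_one, fun z hz => ?_⟩
  rw [minpoly.one, Polynomial.map_sub, Polynomial.map_X, Polynomial.map_one, Polynomial.IsRoot.def,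
    eval_sub, eval_X, eval_one, sub_eq_zero] at hz
  rw [hz, norm_one, Nat.cast_zero, zero_div, Real.rpow_zero]

/-- **Deligne's dévissage (7.2) ⟹ (1.7), abstract form** (Deligne, *La conjecture de Weil. I*,
p. 301, a)–d)), for a Galois Weil cohomology theory `E` over the finite field `k` (`q = #k`) with
`χ(φ) = q`, eigenvalues in a field `L ⊇ K`. Write `W(X, i)` for: every eigenvalue of the
geometric Frobenius `F` on `Hⁱ(X)` is an algebraic number all of whose complex conjugates have
absolute value `q^{i/2}`. **Hypotheses:** Lemme (7.1) for `E` (even dimension, middle degree,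
`q^{d/2-1/2} ≤ |α| ≤ q^{d/2+1/2}`), and the weak-Lefschetz hypothesis **(WL)**: for `X` smooth
projective of dimension `n` and `0 < i < n` there is a smooth projective `Y` over `k` of dimension
`n - 1` such that every eigenvalue of `F` on `Hⁱ(X)` is an eigenvalue of `F` on `Hⁱ(Y)`. (WL) is
the form in which Deligne's steps a) (extension of scalars) and d) ("`W(Y₀, i) ⟹ W(X₀, i)` pour
`Y₀` une section hyperplane lisse et `i < n`: ceci résulte du théorème de Lefschetz faible")
enter; it is an assumption on `E`, not a consequence of the axioms of a Galois Weil cohomology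
theory (over `k` itself a smooth hyperplane section need not exist, which is why Deligne first
extends scalars). **Conclusion:** `W(X, i)` for all smooth projective `X` and all `i ≤ 2 dim X`,
i.e. Lemme (1.7) for `E`. Proof as on p. 301: for `i ≤ n = dim X` by induction on `n` — `i = 0`
by `frobEigenvalue_norm_eq_zero`, `i = n` by (7.2) (`frobEigenvalue_middle_norm_eq_of_even_dim_bound`,
from (7.1) by Künneth), `0 < i < n` by (WL) and the induction hypothesis —, and for `i > n` by
Poincaré duality b) (`frobEigenvalue_norm_eq_of_dual`). [cite: Deligne1974, p. 301 (7.2) ⟹ (1.7)] -/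
theorem frobEigenvalue_norm_eq_of_lemma71_of_weakLefschetz {L : Type*} [Field L] [CharZero L]
    [Algebra K L] (hχ : (χ (arithFrob k) : K) = Nat.card k)
    (h71 : ∀ ⦃d : ℕ⦄ ⦃Y : SchemeOver k⦄ (hY : IsSmoothProjective d Y), Even d → ∀ α : L,
      ((haveI := E.finite_obj hY d; (E.frobAction Y d).charpoly).map (algebraMap K L)).IsRoot α →
        _root_.IsIntegral ℚ α ∧ ∀ z : ℂ, ((minpoly ℚ α).map (algebraMap ℚ ℂ)).IsRoot z →
          (Nat.card k : ℝ) ^ ((d : ℝ) / 2 - 1 / 2) ≤ ‖z‖ ∧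
            ‖z‖ ≤ (Nat.card k : ℝ) ^ ((d : ℝ) / 2 + 1 / 2))
    (hWL : ∀ ⦃n : ℕ⦄ ⦃X : SchemeOver k⦄ (hX : IsSmoothProjective n X) ⦃i : ℕ⦄, 0 < i → i < n →
      ∃ (Y : SchemeOver k) (hY : IsSmoothProjective (n - 1) Y), ∀ α : L,
        ((haveI := E.finite_obj hX i; (E.frobAction X i).charpoly).map
          (algebraMap K L)).IsRoot α →
        ((haveI := E.finite_obj hY i; (E.frobAction Y i).charpoly).map
          (algebraMap K L)).IsRoot α)
    {n : ℕ} {X : SchemeOver k} (hX : IsSmoothProjective n X) {i : ℕ} (hi : i ≤ 2 * n) {α : L}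
    (hα : ((haveI := E.finite_obj hX i; (E.frobAction X i).charpoly).map
      (algebraMap K L)).IsRoot α) :
    _root_.IsIntegral ℚ α ∧ ∀ z : ℂ, ((minpoly ℚ α).map (algebraMap ℚ ℂ)).IsRoot z →
      ‖z‖ = (Nat.card k : ℝ) ^ ((i : ℝ) / 2) := by
  -- degrees `i ≤ dim X`, by induction on the dimension
  have low : ∀ (n : ℕ) (X : SchemeOver k) (hX : IsSmoothProjective n X) (i : ℕ), i ≤ n →
      ∀ α : L, ((haveI := E.finite_obj hX i; (E.frobAction X i).charpoly).map
        (algebraMap K L)).IsRoot α →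
      _root_.IsIntegral ℚ α ∧ ∀ z : ℂ, ((minpoly ℚ α).map (algebraMap ℚ ℂ)).IsRoot z →
        ‖z‖ = (Nat.card k : ℝ) ^ ((i : ℝ) / 2) := by
    intro n
    induction n with
    | zero =>
      intro X hX i hi α hα
      obtain rfl : i = 0 := Nat.le_zero.mp hi
      exact frobEigenvalue_norm_eq_zero E hχ hX hα
    | succ n ih =>
      intro X hX i hi α hα
      rcases Nat.eq_zero_or_pos i with rfl | hi0
      · exact frobEigenvalue_norm_eq_zero E hχ hX hα
      rcases eq_or_lt_of_le hi with rfl | hlt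
      · exact frobEigenvalue_middle_norm_eq_of_even_dim_bound E h71 hX hα
      · obtain ⟨Y, hY, hYev⟩ := hWL hX hi0 hlt
        have hY' : IsSmoothProjective n Y := by simpa using hY
        exact ih Y hY' i (by omega) α (hYev α hα)
  rcases le_or_gt i n with hin | hni
  · exact low n X hX i hin α hα
  · exact frobEigenvalue_norm_eq_of_dual E hχ hX (i := 2 * n - i) (j := i) (by omega)
      (fun β hβ => low n X hX (2 * n - i) (by omega) β hβ) hα

/-- **Theorem (1.6) for `E` from Lemma (7.1) and weak Lefschetz** (Deligne, *Weil I*: (7.3),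
p. 301 a)–d), and (1.7) ⟹ (1.6) pp. 276–277): if the Galois Weil cohomology theory `E` over the
finite field `k` satisfies the Lefschetz trace formula and `χ(φ) = q`, Lemme (7.1) (eigenvalues in an
algebraically closed `L ⊇ K`) and the weak-Lefschetz hypothesis (WL) of
`frobEigenvalue_norm_eq_of_lemma71_of_weakLefschetz`, then `DeligneWeilIStatement E` holds
(`weilRiemannHypothesisFor_of_eigenvalues`). [cite: Deligne1974, §7 and Thm. (1.6)] -/
theorem deligneWeilIStatement_of_lemma71_of_weakLefschetz {L : Type*} [Field L] [CharZero L]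
    [Algebra K L] [IsAlgClosed L] (hE : E.HasLefschetzTraceFormula)
    (hχ : (χ (arithFrob k) : K) = Nat.card k)
    (h71 : ∀ ⦃d : ℕ⦄ ⦃Y : SchemeOver k⦄ (hY : IsSmoothProjective d Y), Even d → ∀ α : L,
      ((haveI := E.finite_obj hY d; (E.frobAction Y d).charpoly).map (algebraMap K L)).IsRoot α →
        _root_.IsIntegral ℚ α ∧ ∀ z : ℂ, ((minpoly ℚ α).map (algebraMap ℚ ℂ)).IsRoot z →
          (Nat.card k : ℝ) ^ ((d : ℝ) / 2 - 1 / 2) ≤ ‖z‖ ∧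
            ‖z‖ ≤ (Nat.card k : ℝ) ^ ((d : ℝ) / 2 + 1 / 2))
    (hWL : ∀ ⦃n : ℕ⦄ ⦃X : SchemeOver k⦄ (hX : IsSmoothProjective n X) ⦃i : ℕ⦄, 0 < i → i < n →
      ∃ (Y : SchemeOver k) (hY : IsSmoothProjective (n - 1) Y), ∀ α : L,
        ((haveI := E.finite_obj hX i; (E.frobAction X i).charpoly).map
          (algebraMap K L)).IsRoot α →
        ((haveI := E.finite_obj hY i; (E.frobAction Y i).charpoly).map
          (algebraMap K L)).IsRoot α) :
    DeligneWeilIStatement E := fun _ _ hX =>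
  weilRiemannHypothesisFor_of_eigenvalues E hE hX fun _ hi _ hα =>
    frobEigenvalue_norm_eq_of_lemma71_of_weakLefschetz E hχ h71 hWL hX hi hα

/-- **The Weil conjectures for `Z(X, T)` from the cohomological formalism, Deligne's Lemma (7.1)
and weak Lefschetz** (Deligne, *Weil I*, (1.5.4), (2.5), §7, Thm. (1.6)): a Galois Weil cohomology
theory over the finite field `k` with the Lefschetz trace formula, `χ(φ) = q`, Lemme (7.1) and the
weak-Lefschetz hypothesis (WL) yields `exists_isWeilFactorization` over `k`
(`exists_isWeilFactorization_of_galoisWeilCohomology` with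
`deligneWeilIStatement_of_lemma71_of_weakLefschetz`). Compared with
`exists_isWeilFactorization_of_frobCharPoly_dvd` ((1.7) as input), the unproved inputs are now the
two geometric statements (7.1) (Lefschetz pencils, Kazhdan–Margulis, Rankin: §§3–6) and (WL).
[cite: Deligne1974, §7 and Thm. (1.6)] -/
theorem exists_isWeilFactorization_of_lemma71_of_weakLefschetz
    (E : GaloisWeilCohomology k K χ) {L : Type*} [Field L] [CharZero L] [Algebra K L]
    [IsAlgClosed L] (hE : E.HasLefschetzTraceFormula) (hχ : (χ (arithFrob k) : K) = Nat.card k)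
    (h71 : ∀ ⦃d : ℕ⦄ ⦃Y : SchemeOver k⦄ (hY : IsSmoothProjective d Y), Even d → ∀ α : L,
      ((haveI := E.finite_obj hY d; (E.frobAction Y d).charpoly).map (algebraMap K L)).IsRoot α →
        _root_.IsIntegral ℚ α ∧ ∀ z : ℂ, ((minpoly ℚ α).map (algebraMap ℚ ℂ)).IsRoot z →
          (Nat.card k : ℝ) ^ ((d : ℝ) / 2 - 1 / 2) ≤ ‖z‖ ∧
            ‖z‖ ≤ (Nat.card k : ℝ) ^ ((d : ℝ) / 2 + 1 / 2))
    (hWL : ∀ ⦃n : ℕ⦄ ⦃X : SchemeOver k⦄ (hX : IsSmoothProjective n X) ⦃i : ℕ⦄, 0 < i → i < n →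
      ∃ (Y : SchemeOver k) (hY : IsSmoothProjective (n - 1) Y), ∀ α : L,
        ((haveI := E.finite_obj hX i; (E.frobAction X i).charpoly).map
          (algebraMap K L)).IsRoot α →
        ((haveI := E.finite_obj hY i; (E.frobAction Y i).charpoly).map
          (algebraMap K L)).IsRoot α) :
    exists_isWeilFactorization (k := k) :=
  exists_isWeilFactorization_of_galoisWeilCohomology E hE hχ
    (deligneWeilIStatement_of_lemma71_of_weakLefschetz E hE hχ h71 hWL)

end Devissage

end Literature.NumberTheory.LFunctions

end
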